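import Mathlib
import HarnessLib
import Summits.CriticalPhenomena.PercolationContinuityZ3.Theses.PercBudgetLadder
import Literature.Probability.Percolation.MinOpenCut

/-!
# Card `bk-first-moment-reduction`, First lemma (a), PROVED:
# `MeanCutBoundedIO → BudgetTightness` (Markov on the critical annulus min-cut)

crux-ideate stmt-CriticalPhenomena-5248, ideator 2, round 1.
-/

noncomputable section

namespace Summit.CriticalPhenomena.PercolationContinuityZ3.Cruxes.BudgetTightness.SketchIdeator2

open MeasureTheory
open Literature.Probability.Percolation Literature.Probability.LatticeModels
open Summit.CriticalPhenomena.PercolationContinuityZ3.Theses.PercBudgetLadder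

/-- Critical bond percolation on `ℤ³`. -/
abbrev Pc' : Measure (BondConfig (Site 3)) := bondPercolation (zdGraph 3) (criticalProbI 3)

/-- The critical min-cut budget of the annulus `box m → ∂ⁱⁿ box (l m)` inside `box (l m)`. -/
def annulusMinCut' (m l : ℕ) (ω : BondConfig (Site 3)) : ℕ∞ :=
  minOpenCutIn (↑(box 3 (l * m)) : Set (Site 3)) (↑(box 3 m) : Set (Site 3))
    (↑(innerBoundary (zdGraph 3) (box 3 (l * m))) : Set (Site 3)) ω

/-- Bounded expected critical annulus min-cut along a subsequence (the transfer `C⁺` of the card). -/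
def MeanCutBoundedIO' : Prop :=
  ∃ (l : ℕ) (C : ℝ), 2 ≤ l ∧ ∀ N : ℕ, ∃ n : ℕ, N ≤ n ∧
    ∫ ω, ((annulusMinCut' n l ω).toNat : ℝ) ∂Pc' ≤ C

/-- For `1 ≤ n`, `2 ≤ l` the inner box misses the inner vertex boundary of the outer box. -/
theorem not_mem_innerBoundary_of_mem_box {n l : ℕ} (hn : 1 ≤ n) (hl : 2 ≤ l) {x : Site 3}
    (hx : x ∈ box 3 n) : x ∉ innerBoundary (zdGraph 3) (box 3 (l * n)) := by
  intro hxb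
  rw [mem_innerBoundary_iff] at hxb
  obtain ⟨-, y, hy, hadj⟩ := hxb
  rw [mem_box] at hx hy
  apply hy
  have hln : (n : ℤ) + 1 ≤ ((l * n : ℕ) : ℤ) := by push_cast; nlinarith
  rw [zdGraph_adj_iff] at hadj
  obtain ⟨i, h | h⟩ := hadj
  · intro j
    have hxj := hx j
    rw [h, Pi.add_apply]
    by_cases hji : j = i
    · subst hji; simp; constructor <;> omega
    · rw [Pi.single_eq_of_ne hji]; constructor <;> omega
  · intro j
    have hxj := hx j
    have : y j = x j - (Pi.single i (1 : ℤ) : Fin 3 → ℤ) j := by rw [h, Pi.add_apply]; ring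
    rw [this]
    by_cases hji : j = i
    · subst hji; simp; constructor <;> omega
    · rw [Pi.single_eq_of_ne hji]; constructor <;> omega

/-- Closing every pair of vertices of the outer box is an open cutset (for `1 ≤ n`, `2 ≤ l`). -/
theorem isOpenCutsetIn_allPairs {n l : ℕ} (hn : 1 ≤ n) (hl : 2 ≤ l) (ω : BondConfig (Site 3)) :
    IsOpenCutsetIn (↑(box 3 (l * n)) : Set (Site 3)) ↑(box 3 n)
      ↑(innerBoundary (zdGraph 3) (box 3 (l * n))) ω ↑((box 3 (l * n)).sym2) := by
  intro x hx y hy hconn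
  obtain ⟨hxS, hyS, hreach⟩ := hconn
  obtain ⟨w⟩ := hreach
  cases w with
  | nil => exact not_mem_innerBoundary_of_mem_box hn hl (Finset.mem_coe.1 hx) (Finset.mem_coe.1 hy)
  | cons hadj w' =>
    rename_i v
    have h1 := SimpleGraph.induce_adj.1 hadj
    rw [openGraph_adj] at h1
    obtain ⟨⟨hmem, hnot⟩, -⟩ := h1
    apply hnot
    rw [Finset.mem_coe, Finset.mk_mem_sym2_iff]
    exact ⟨Finset.mem_coe.1 hxS, Finset.mem_coe.1 v.2⟩

/-- The annulus min-cut is bounded by the number of pairs in the outer box. -/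
theorem annulusMinCut'_le_card {n l : ℕ} (hn : 1 ≤ n) (hl : 2 ≤ l) (ω : BondConfig (Site 3)) :
    annulusMinCut' n l ω ≤ ((box 3 (l * n)).sym2).card :=
  minOpenCutIn_le_card (isOpenCutsetIn_allPairs hn hl ω)

/-- Level sets of the annulus min-cut are measurable. -/
theorem measurableSet_annulusMinCut'_le (n l k : ℕ) :
    MeasurableSet {ω | annulusMinCut' n l ω ≤ k} :=
  measurableSet_setOf_minOpenCutIn_le (Finset.finite_toSet _) _ _ k

/-- The annulus min-cut is a measurable `ℕ∞`-valued map. -/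
theorem measurable_annulusMinCut' (n l : ℕ) : Measurable (annulusMinCut' n l) := by
  rw [ENat.measurable_iff]
  intro k
  rcases Nat.eq_zero_or_pos k with rfl | hk
  · have : annulusMinCut' n l ⁻¹' {((0 : ℕ) : ℕ∞)} = {ω | annulusMinCut' n l ω ≤ (0 : ℕ)} := by
      ext ω
      simp only [Set.mem_preimage, Set.mem_singleton_iff, Set.mem_setOf_eq, Nat.cast_zero,
        nonpos_iff_eq_zero]
    rw [this]; exact measurableSet_annulusMinCut'_le n l 0
  · have : annulusMinCut' n l ⁻¹' {(k : ℕ∞)} =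
        {ω | annulusMinCut' n l ω ≤ k} \ {ω | annulusMinCut' n l ω ≤ (k - 1 : ℕ)} := by
      ext ω
      simp only [Set.mem_preimage, Set.mem_singleton_iff, Set.mem_sdiff, Set.mem_setOf_eq]
      constructor
      · intro h
        rw [h]
        refine ⟨le_rfl, fun h' => ?_⟩
        have := Nat.cast_le.1 (show ((k : ℕ) : ℕ∞) ≤ (k - 1 : ℕ) from h')
        omega
      · rintro ⟨h1, h2⟩
        have hne : annulusMinCut' n l ω ≠ ⊤ := by
          intro htop; rw [htop] at h1; exact absurd h1 (by simp)
        obtain ⟨j, hj⟩ := ENat.ne_top_iff_exists.1 hne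
        rw [← hj] at h1 h2 ⊢
        have h1' := Nat.cast_le.1 (show ((j : ℕ) : ℕ∞) ≤ k from h1)
        have h2' : ¬ j ≤ k - 1 := fun h => h2 (by exact_mod_cast h)
        congr 1
        omega
    rw [this]
    exact (measurableSet_annulusMinCut'_le n l k).diff (measurableSet_annulusMinCut'_le n l (k - 1))

/-- **First lemma (a) of card `bk-first-moment-reduction`, PROVED**: a bounded expected critical
annulus min-cut along a subsequence gives `BudgetTightness` (Markov's inequality). -/
theorem budgetTightness_of_meanCutBoundedIO' (h : MeanCutBoundedIO') : BudgetTightness := by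
  obtain ⟨l, C, hl, hio⟩ := h
  -- the budget: any natural `k` with `2 C ≤ k`
  obtain ⟨k, hk⟩ : ∃ k : ℕ, 2 * C ≤ k := ⟨⌈2 * C⌉₊, Nat.le_ceil _⟩
  refine ⟨k, l, 1 / 2, hl, by norm_num, fun N => ?_⟩
  obtain ⟨n, hn, hint⟩ := hio (max N 1)
  have hn1 : 1 ≤ n := le_trans (le_max_right _ _) hn
  refine ⟨n, le_trans (le_max_left _ _) hn, ?_⟩
  -- the route's event is `{MinCut ≤ k}`
  have hev : {ω : BondConfig (Site 3) | ∃ S : Finset (Sym2 (Site 3)), S.card ≤ k ∧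
      ¬ ∃ x ∈ box 3 n, ∃ y ∈ innerBoundary (zdGraph 3) (box 3 (l * n)),
        (ω \ ↑S) ∈ openConnIn (↑(box 3 (l * n)) : Set (Site 3)) x y} =
      {ω | annulusMinCut' n l ω ≤ k} := by
    ext ω
    simp only [Set.mem_setOf_eq, annulusMinCut', minOpenCutIn_le_iff, Finset.mem_coe]
  rw [hev]
  -- the real-valued min-cut
  set g : BondConfig (Site 3) → ℝ := fun ω => ((annulusMinCut' n l ω).toNat : ℝ) with hg
  have hgm : Measurable g := by
    have h1 : Measurable fun ω => (annulusMinCut' n l ω).toNat :=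
      (measurable_of_countable ENat.toNat).comp (measurable_annulusMinCut' n l)
    exact (measurable_of_countable (fun j : ℕ => (j : ℝ))).comp h1
  have hg0 : ∀ ω, 0 ≤ g ω := fun ω => by simp [hg]
  set K : ℕ := ((box 3 (l * n)).sym2).card with hK
  have hgK : ∀ ω, g ω ≤ K := by
    intro ω
    have hle := annulusMinCut'_le_card hn1 hl ω
    have hne : annulusMinCut' n l ω ≠ ⊤ := ne_top_of_le_ne_top (ENat.coe_ne_top K) hle
    obtain ⟨j, hj⟩ := ENat.ne_top_iff_exists.1 hne
    simp only [hg, ← hj, ENat.toNat_coe, Nat.cast_le]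
    rw [← hj] at hle
    exact_mod_cast hle
  have hgi : Integrable g Pc' :=
    Integrable.of_bound hgm.aestronglyMeasurable K
      (Filter.Eventually.of_forall fun ω => by
        rw [Real.norm_eq_abs, abs_of_nonneg (hg0 ω)]; exact hgK ω)
  -- Markov at level `k + 1`
  have hmarkov := mul_meas_ge_le_integral_of_nonneg (μ := Pc')
    (Filter.Eventually.of_forall hg0) hgi ((k : ℝ) + 1)
  -- `{MinCut ≤ k}ᶜ = {k + 1 ≤ g}`
  have hcompl : {ω | annulusMinCut' n l ω ≤ k}ᶜ = {ω | (k : ℝ) + 1 ≤ g ω} := by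
    ext ω
    simp only [Set.mem_compl_iff, Set.mem_setOf_eq, not_le, hg]
    have hne : annulusMinCut' n l ω ≠ ⊤ :=
      ne_top_of_le_ne_top (ENat.coe_ne_top K) (annulusMinCut'_le_card hn1 hl ω)
    obtain ⟨j, hj⟩ := ENat.ne_top_iff_exists.1 hne
    rw [← hj, ENat.toNat_coe]
    constructor
    · intro h
      have : k < j := by exact_mod_cast h
      exact_mod_cast (show k + 1 ≤ j by omega)
    · intro h
      have : (k : ℝ) + 1 ≤ (j : ℝ) := h
      have : k + 1 ≤ j := by exact_mod_cast this
      exact_mod_cast (show k < j by omega)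
  have hmeas : MeasurableSet {ω | annulusMinCut' n l ω ≤ k} := measurableSet_annulusMinCut'_le n l k
  have hprob : Pc'.real {ω | annulusMinCut' n l ω ≤ k} = 1 - Pc'.real {ω | (k : ℝ) + 1 ≤ g ω} := by
    rw [← hcompl, measureReal_compl hmeas, probReal_univ]
    ring
  rw [hprob]
  -- `(k+1) · P(g ≥ k+1) ≤ ∫ g ≤ C ≤ (k+1)/2`
  have hkpos : (0 : ℝ) < (k : ℝ) + 1 := by positivity
  have hP : Pc'.real {ω | (k : ℝ) + 1 ≤ g ω} ≤ C / ((k : ℝ) + 1) := by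
    rw [le_div_iff₀ hkpos, mul_comm]
    exact hmarkov.trans hint
  have hC : C / ((k : ℝ) + 1) ≤ 1 / 2 := by
    rcases le_or_gt C 0 with hC0 | hC0
    · exact (div_nonpos_of_nonpos_of_nonneg hC0 hkpos.le).trans (by norm_num)
    · rw [div_le_iff₀ hkpos]; linarith
  linarith

end Summit.CriticalPhenomena.PercolationContinuityZ3.Cruxes.BudgetTightness.SketchIdeator2

end
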